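import Mathlib
import Summits.NavierStokesRegularity.NavierStokesRegularity.Theorems.WakeRatchetEternalInviscidRateDSSRate
import HarnessLib
import HarnessLib.Audit

/-!
# `WakeRatchet.EternalInviscidRate` (stmt-NavierStokesRegularity-25646) — negative lemma modulo
# SLOW FIXED-SPREAD DSS FRONTS: the crux read on the self-similar stratum is exactly the non-existence
# of admissible inviscid DSS fronts whose retention exponent is not bounded away from the dissipation line

THE POINT.  `EternalInviscidRate` reads `∀ R ≥ 1, ∃ a > 1, ∃ εs > 0, ∀ ε₀ ∈ (0, εs], ∀ α ∈ E₂(R), ∀ W` (uniformly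
bounded admissible INVISCID eternal solution) «tail above `n` bounded by `M` at all log-times ⇒ tail above `n+1`
bounded by `(1+ε₀)^{-a} M` at all log-times».  Along the eternal solution carried by an admissible discretely
self-similar blow-up wave (`IsDSSWave ε₀ α π T Φ`, `dssEmbed`) the tail envelope contracts per shell by EXACTLY
the retention `dssMu ε₀ T = e^{2T}/(1+ε₀)^5` (tree: `WakeRatchetDSS.dssMu_le_of_rateContraction`,
`dssMu_le_of_eternalInviscidRate`, helper file `…EternalInviscidRateDSSRate`, p819021).  Writing the retention as
`dssMu = (1+ε₀)^{-κ}` (retention EXPONENT `κ`; Kolmogorov fronts have `κ → 5/3`, the dissipation / survival line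
is `κ = 1`), the crux restricted to the self-similar stratum says precisely

  «for every spread `R ≥ 1` there is `a(R) > 1` with `κ ≥ a(R)` for every non-trivial admissible DSS front of
   every `E₂(R)` table at every sufficiently small scale ratio» ,

and its negation on that stratum is the construction item `SlowDSSFronts` below: at ONE fixed spread, for
every `a > 1`, fronts with `κ ≤ a` at arbitrarily small scale ratios (retention exponent NOT bounded away from
`1` as `ε₀ → 0`).  This file records

* `SlowDSSFronts` (construction item, `@[conjecture]`);
* `EternalInviscidRate_false_of_SlowDSSFronts : SlowDSSFronts → ¬ EternalInviscidRate` (the negative lemma);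
* `slowDSSFronts_of_survivingDSSFronts` — fronts ON the survival line (`(1+ε₀)^{-1} ≤ dssMu`, the hypothesis
  of the tree's kill criterion `EternalInviscidRate_false_of_survivingDSSWaves`) are slow fronts;
* `slowDSSFronts_of_not_noSurvivingDSS` — in the tree's K1 vocabulary: if the Liouville predicate
  `NoSurvivingDSS R 1` (`SelfSimilarCascadeBlowup`) FAILS at some spread `R ≥ 1`, then `SlowDSSFronts`.

WHY `SlowDSSFronts` IS NOT CONSTRUCTED HERE (status, honest).  No admissible DSS blow-up front of ANY comparable
table at fixed spread is constructed in print or in the tree (the scalar dyadic front is itself the open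
construction item `WakeRatchetScalarFront.DyadicScalarFronts` of stmt-21808; Tao's blow-up, arXiv:1402.0290
Thm. 4.2, is not exactly self-similar; the printed exactly self-similar dyadic solutions — Barbato–Flandoli–
Morandin arXiv:0811.1689 p. 3, Jeong arXiv:1705.01456 Thm. 1 — are the separable family excluded by the `mass`
/ `bdd` clauses of `IsDSSWave`).  Moreover the route's own instrument rows point the OTHER way at fixed spread:
the numerically computed fronts of the dyadic member have `1 − dssMu ≈ 1.66 ε₀` (`κ → 5/3`, the Kolmogorov
rate; evidence RESULT-E-g10-1/2 on the item), and tuned rotor circuits of `E₂(R)` reach `κ ≤ 1` only for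
`ε₀ ≳ 0.2 R^{-0.6}` (cross-route numerics NUMERICS-20419 on the item), i.e. OUTSIDE the crux's window
`ε₀ ≤ εs(R)`.  So `SlowDSSFronts` is OPEN and, on present evidence, not expected at any fixed spread; the value
of this file is the exact placement: a refutation of ⟨25646⟩ through self-similar fronts is EQUIVALENT to
constructing `SlowDSSFronts`, and every other refutation must exhibit a NON-self-similar bounded eternal
solution (log-time chaotic cascades, arXiv:2501.07377) with the same slow tail contraction.  Compare the
viscous sibling ⟨25647⟩, refuted modulo `WakeRatchetViscDSS.ViscousBlockDSSWaves` (bare existence kills there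
because the covariant viscosity pins `κ = 1`; here nothing pins `κ`, so the hypothesis must carry the rate).

HONEST FRAMING: MODEL lattice ODEs only (Tao 2016 §4 renormalised cascade, §6.4); nothing here is a statement
about the Navier–Stokes equations; no registered stub of skeleton d183ebc25b56 is closed; no verdict changes;
no summit statement is proved or refuted.
-/

noncomputable section

set_option linter.dupNamespace false

namespace Summit.NavierStokesRegularity.NavierStokesRegularity.Theorems

namespace WakeRatchetInviscidFronts

open Filter Topology
open Literature.Analysis.FluidPDE Literature.Analysis.FluidPDE.TaoCascade
open Summit.NavierStokesRegularity.NavierStokesRegularity.Theorems.WakeRatchetDSS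

/-! ## The construction item and the negative lemma -/

/-- **Construction item for ⟨25646⟩: SLOW FIXED-SPREAD DSS FRONTS.**  At some spread `R ≥ 1`: for every rate
`a > 1` and every threshold `εs > 0` there are a scale ratio `ε₀ ∈ (0, εs]`, a table `α ∈ E₂(R)` (`m = 4`) and a
non-trivial admissible discretely self-similar blow-up wave of `α` (profile family `Φ : Fin q → ℝ → Em 4`, shape
permutation `π`, delay `T`; `IsDSSWave ε₀ α π T Φ`) whose per-shell energy retention is AT LEAST the rate-`a`
survival weight, `(1+ε₀)^{-a} ≤ dssMu ε₀ T` — in exponent currency `dssMu = (1+ε₀)^{-κ}`: fronts with `κ ≤ a`,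
for every `a > 1`, at arbitrarily small scale ratios on ONE comparable class (retention exponent not bounded away
from the dissipation line `κ = 1`).  Exactly the negation of `EternalInviscidRate` restricted to the self-similar
stratum.  Not constructed; numerically NOT expected at fixed spread (`κ → 5/3` on the dyadic member); see the
module docstring.
[cite: Tao2016AveragedNS, §4 Lemma 4.1 (4.8)–(4.10), Thm. 4.2 (statement shape), §6.4; cell vocabulary (construction item for stmt-NavierStokesRegularity-25646)] -/
@[conjecture] def SlowDSSFronts : Prop :=
  ∃ R : ℝ, 1 ≤ R ∧ ∀ a : ℝ, 1 < a → ∀ εs : ℝ, 0 < εs → ∃ ε₀ : ℝ, 0 < ε₀ ∧ ε₀ ≤ εs ∧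
    ∃ α : Fin 4 → Fin 4 → Fin 4 → ℤ × ℤ × ℤ → ℝ, InTableClass R α ∧
      ∃ (q : ℕ) (π : Equiv.Perm (Fin q)) (T : ℝ) (Φ : Fin q → ℝ → Em 4),
        IsDSSWave ε₀ α π T Φ ∧ (∃ r x, Φ r x ≠ 0) ∧ (1 + ε₀) ^ (-a) ≤ dssMu ε₀ T

/-- **Negative lemma: `SlowDSSFronts → ¬ EternalInviscidRate`.**  Given the crux, at the spread `R` of the
hypothesis take its rate `a(R) > 1` and threshold `εs(R)`; the hypothesis at the intermediate rate
`a' := (1 + a(R))/2 ∈ (1, a(R))` supplies a non-trivial admissible DSS front below `εs(R)` with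
`(1+ε₀)^{-a'} ≤ dssMu`, while the crux pins `dssMu ≤ (1+ε₀)^{-a(R)} < (1+ε₀)^{-a'}`
(`WakeRatchetDSS.dssMu_le_of_eternalInviscidRate`).  MODEL lattice only; no verdict changes.
[cite: Tao2016AveragedNS, §4 Lemma 4.1 (4.8)–(4.10), Thm. 4.2 (statement shape), §6.4; cell vocabulary (stmt-NavierStokesRegularity-25646)] -/
theorem EternalInviscidRate_false_of_SlowDSSFronts :
    SlowDSSFronts →
      ¬ Summit.NavierStokesRegularity.NavierStokesRegularity.Theses.WakeRatchet.EternalInviscidRate := by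
  rintro ⟨R, hR, H⟩ hK
  obtain ⟨a, ha, εs, hεs, hpin⟩ := dssMu_le_of_eternalInviscidRate hK hR
  have ha' : 1 < (1 + a) / 2 := by linarith
  obtain ⟨ε₀, hε₀, hle, α, hα, q, π, T, Φ, hW, hne, hslow⟩ := H ((1 + a) / 2) ha' εs hεs
  have hμ : dssMu ε₀ T ≤ (1 + ε₀) ^ (-a) := hpin ε₀ hε₀ hle α hα q π T Φ hW hne
  have h1 : 1 < 1 + ε₀ := by linarith
  have hlt : (1 + ε₀) ^ (-a) < (1 + ε₀) ^ (-((1 + a) / 2)) :=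
    Real.rpow_lt_rpow_of_exponent_lt h1 (by linarith)
  exact absurd (hslow.trans hμ) (not_le.mpr hlt)

/-! ## Sufficient forms in the tree's vocabulary -/

/-- **Fronts on the survival line are slow fronts.**  If at some fixed spread `R ≥ 1` there are, at arbitrarily
small scale ratios, non-trivial admissible DSS waves of `E₂(R)` tables with retention at or above the dissipation
line, `(1+ε₀)^{-1} ≤ dssMu ε₀ T` (the hypothesis of the tree's kill criterion
`WakeRatchetDSS.EternalInviscidRate_false_of_survivingDSSWaves`), then `SlowDSSFronts` holds (for `a > 1`,
`(1+ε₀)^{-a} ≤ (1+ε₀)^{-1}`).  MODEL lattice only.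
[cite: Tao2016AveragedNS, §4 Thm. 4.2 (statement shape), §6.4; cell vocabulary (stmt-NavierStokesRegularity-25646)] -/
theorem slowDSSFronts_of_survivingDSSFronts
    (h : ∃ R : ℝ, 1 ≤ R ∧ ∀ εs : ℝ, 0 < εs → ∃ ε₀ : ℝ, 0 < ε₀ ∧ ε₀ ≤ εs ∧
      ∃ α : Fin 4 → Fin 4 → Fin 4 → ℤ × ℤ × ℤ → ℝ, InTableClass R α ∧
        ∃ (q : ℕ) (π : Equiv.Perm (Fin q)) (T : ℝ) (Φ : Fin q → ℝ → Em 4),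
          IsDSSWave ε₀ α π T Φ ∧ (∃ r x, Φ r x ≠ 0) ∧ (1 + ε₀) ^ (-(1 : ℝ)) ≤ dssMu ε₀ T) :
    SlowDSSFronts := by
  obtain ⟨R, hR, H⟩ := h
  refine ⟨R, hR, fun a ha εs hεs => ?_⟩
  obtain ⟨ε₀, hε₀, hle, α, hα, q, π, T, Φ, hW, hne, hS⟩ := H εs hεs
  refine ⟨ε₀, hε₀, hle, α, hα, q, π, T, Φ, hW, hne, le_trans ?_ hS⟩
  have h1 : (1 : ℝ) ≤ 1 + ε₀ := by linarith
  exact Real.rpow_le_rpow_of_exponent_le h1 (by linarith)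

/-- **In K1 vocabulary: a failure of `NoSurvivingDSS R 1` at some spread gives slow fronts.**  If for some
`R ≥ 1` the tree's Liouville predicate `NoSurvivingDSS R 1` (`SelfSimilarCascadeBlowup`: below a threshold no
`E₂(R)` table carries a non-trivial admissible (S₁)-surviving DSS wave) is FALSE, then `SlowDSSFronts` holds —
the negation supplies, below every threshold, a non-trivial admissible DSS wave with
`(1+ε₀)^{-1} ≤ dssMu ε₀ T < 1`.  MODEL lattice only.
[cite: Tao2016AveragedNS, §4 Thm. 4.2 (statement shape), §6.4; cell vocabulary (stmt-NavierStokesRegularity-25646)] -/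
theorem slowDSSFronts_of_not_noSurvivingDSS (h : ∃ R : ℝ, 1 ≤ R ∧ ¬ NoSurvivingDSS R 1) :
    SlowDSSFronts := by
  obtain ⟨R, hR, hN⟩ := h
  refine slowDSSFronts_of_survivingDSSFronts ⟨R, hR, fun εs hεs => ?_⟩
  by_contra hcon
  apply hN
  refine ⟨εs, hεs, fun ε₀ hε₀ hle α hα q π T Φ hW hS => ?_⟩
  by_contra hne
  push Not at hne
  obtain ⟨r, x, hrx⟩ := hne
  exact hcon ⟨ε₀, hε₀, hle, α, hα, q, π, T, Φ, hW, ⟨r, x, hrx⟩, hS.1⟩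

end WakeRatchetInviscidFronts

end Summit.NavierStokesRegularity.NavierStokesRegularity.Theorems

end
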